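import Mathlib
import Summits.ValiantsHypothesis.ValiantsHypothesis.Theses.RigidityForcesSymmetry
import Summits.ValiantsHypothesis.ValiantsHypothesis.Theorems.RigidityForcesSymmetryRankRigidMinimalReprLaplaceFourFiveRefutation

/-!
# Item closer: the route statement `LaplaceOptimalFourFive` (LO(4,5), stmt-ValiantsHypothesis-27319) is REFUTED

The route file `Theses/RigidityForcesSymmetry.lean` carries LO(4,5) — «every split-rank-one decomposition of the `4`-slot, `5`-letter
injective pattern has weighted count `≥ 10` (weights `1 / 2 / 10` for `|S_t| ∈ {2} / {1,3} / {0,4}`)» — verbatim as the definition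
`…Theorems.RigidityForcesSymmetryRankRigidMinimalRepr.LaplaceOptimalFourFive` of `…LaplaceFourFiveDefs.lean`.  The kernel theorem
`LaplaceFourFiveRefutation.not_laplaceOptimalFourFive` (`…LaplaceFourFiveRefutation.lean`: an explicit nine-pair-term integer identity
`Σ_t U_t W_t = 9 · [v injective]` on all `625` points, weighted count `9 < 10`) refutes that definition; this file restates the negation
against the ROUTE declaration so the ledger item closes as `refuted` (class: substantive — the load-bearing bound `10` is false; an
eight-term identity of weight `8` also exists, HOME/lmr/p8g12-LO45-refutation/identity8.json, so «bound 9» is false as well).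

HONEST FRAMING: a negative result on one support item of route `RigidityForcesSymmetry`; `LaplaceOptimalFive` (stmt-24813), the crux
`RankRigidMinimalRepr` (stmt-18034) and `VP ≠ VNP` are untouched.
-/

set_option autoImplicit false

-- the mandated summit-side namespace repeats a component by design (single-problem summit)
set_option linter.dupNamespace false

namespace Summit.ValiantsHypothesis.ValiantsHypothesis.Theorems

/-- **LO(4,5) is false** (route-statement form): the negation of
`Summit.ValiantsHypothesis.ValiantsHypothesis.Theses.RigidityForcesSymmetry.LaplaceOptimalFourFive`, by the explicit weight-`9`
decomposition of `…RankRigidMinimalRepr.LaplaceFourFiveRefutation.not_laplaceOptimalFourFive`.  refuted-substantive: witness = nine pair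
terms `(U_t/9) ⊗ W_t` (four across `{0,1}|{2,3}`, four across `{0,2}|{1,3}`, one across `{0,3}|{1,2}`); no cheap repair: weight `8` is also
attained, and the statement's role (a `≥ 10` transfer hypothesis) needs the full bound. -/
theorem not_LaplaceOptimalFourFive :
    ¬ Summit.ValiantsHypothesis.ValiantsHypothesis.Theses.RigidityForcesSymmetry.LaplaceOptimalFourFive :=
  RigidityForcesSymmetryRankRigidMinimalRepr.LaplaceFourFiveRefutation.not_laplaceOptimalFourFive

end Summit.ValiantsHypothesis.ValiantsHypothesis.Theorems
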